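import Summits.ValiantsHypothesis.ValiantsHypothesis.Theorems.DefinabilityGapPivotColumn
import HarnessLib

/-!
# Definability gap, ROAD P: one ALTERATION step, deterministically (N1 v2 §(5))

The combinatorial skeleton of a re-pick round of PLAN-N1-v2 §(5).  Given a row assignment `r`,
a pivot column `s₀` and a priority `key`, the MOVERS are the curves colliding (same pivot cell)
with a partner of no smaller key; the movers get new rows `r'` and the MERGED assignment takes
`r'` on the movers and `r` elsewhere.

* `movers`, `mem_movers`, `movers_subset_notFree` (`#movers ≤ #non-free curves ≤ collCount`);
* `nonmovers_free` — two non-movers never collide (of a colliding pair the one of smaller-or-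
  equal key moves);
* **`free_mergeRows`** — if, moreover, every mover's new row is not blocked by a non-mover
  (`r c' ≠ r' c` for the non-mover co-curves `c'` through its new pivot cell) and the movers do
  not collide among themselves under `r'`, then the merged assignment has the pivot column free
  at EVERY pivot row — clause 1 of `KIPivotFewBad` (`pivots_injective_iff`);
* `mergeRows_mem` — admissibility / the row rule survive the merge.

No probability here: the weights of the events "many movers", "many blocked rows", "movers
collide again" are bounded in `DefinabilityGapMovers` / `DefinabilityGapBlockedRows`.
-/

namespace Summit.ValiantsHypothesis.ValiantsHypothesis.Theorems.DefinabilityGapAlterationStep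

open Finset
open Literature.Computability.AlgebraicComplexity Literature.Computability.MetaComplexity
open Summit.ValiantsHypothesis.ValiantsHypothesis.Theorems.DefinabilityGapAffineRung
open Summit.ValiantsHypothesis.ValiantsHypothesis.Theorems.DefinabilityGapPivotCertificate
open Summit.ValiantsHypothesis.ValiantsHypothesis.Theorems.DefinabilityGapPivotAdmissible
open Summit.ValiantsHypothesis.ValiantsHypothesis.Theorems.DefinabilityGapCrowdedFree
open Summit.ValiantsHypothesis.ValiantsHypothesis.Theorems.DefinabilityGapPivotColumn

variable {m : ℕ}

/-! ## 1. Movers -/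

open scoped Classical in
/-- The MOVERS of `r` for pivot column `s₀` and priority `key`: curves of `T` colliding with a
co-curve of no smaller key. [this file] -/
noncomputable def movers (T : Finset (Fin 3 → Fin (qOf m))) (s₀ : Fin m)
    (r : (Fin 3 → Fin (qOf m)) → Fin m) (key : (Fin 3 → Fin (qOf m)) → ℕ) :
    Finset (Fin 3 → Fin (qOf m)) :=
  T.filter fun c => ∃ c' ∈ coCurves T c (r c, s₀), r c' = r c ∧ key c ≤ key c'

open scoped Classical in
/-- Membership in `movers`. [this file] -/
theorem mem_movers {T : Finset (Fin 3 → Fin (qOf m))} {s₀ : Fin m}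
    {r : (Fin 3 → Fin (qOf m)) → Fin m} {key : (Fin 3 → Fin (qOf m)) → ℕ}
    {c : Fin 3 → Fin (qOf m)} :
    c ∈ movers T s₀ r key ↔ c ∈ T ∧ ∃ c' ∈ coCurves T c (r c, s₀), r c' = r c ∧ key c ≤ key c' := by
  unfold movers
  rw [Finset.mem_filter]

open scoped Classical in
/-- Movers are non-free curves: `movers ⊆ {c ∈ T : s₀ ∉ freeCols T c r (r c)}`. [this file] -/
theorem movers_subset_notFree (T : Finset (Fin 3 → Fin (qOf m))) (s₀ : Fin m)
    (r : (Fin 3 → Fin (qOf m)) → Fin m) (key : (Fin 3 → Fin (qOf m)) → ℕ) :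
    movers T s₀ r key ⊆ T.filter fun c => s₀ ∉ freeCols T c r (r c) := by
  intro c hc
  obtain ⟨hcT, c', hc', hrc', -⟩ := mem_movers.mp hc
  exact Finset.mem_filter.mpr ⟨hcT, fun hfree => (mem_freeCols.mp hfree) c' hc' hrc'⟩

/-- Symmetry of co-incidence at a shared pivot row: if `c'` is a co-curve of `c` through
`(i, s₀)` and `c ∈ T`, then `c` is a co-curve of `c'` through `(i, s₀)`. [this file] -/
theorem mem_coCurves_symm {T : Finset (Fin 3 → Fin (qOf m))} {c c' : Fin 3 → Fin (qOf m)}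
    {p : Fin m × Fin m} (hc : c ∈ T) (h : c' ∈ coCurves T c p) : c ∈ coCurves T c' p := by
  obtain ⟨-, hne, heq⟩ := mem_coCurves.mp h
  exact mem_coCurves.mpr ⟨hc, fun h' => hne h'.symm, heq.symm⟩

open scoped Classical in
/-- **Non-movers never collide**: for `c ∈ T` not a mover and a co-curve `c' ∈ T` of `c`
through its pivot cell with `r c' = r c`, the partner `c'` is a mover. [this file] -/
theorem nonmovers_free {T : Finset (Fin 3 → Fin (qOf m))} {s₀ : Fin m}
    {r : (Fin 3 → Fin (qOf m)) → Fin m} {key : (Fin 3 → Fin (qOf m)) → ℕ}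
    {c c' : Fin 3 → Fin (qOf m)} (hc : c ∈ T) (hcM : c ∉ movers T s₀ r key)
    (hc' : c' ∈ coCurves T c (r c, s₀)) (hrc' : r c' = r c) : c' ∈ movers T s₀ r key := by
  have hc'T : c' ∈ T := (mem_coCurves.mp hc').1
  by_cases hk : key c ≤ key c'
  · exact absurd (mem_movers.mpr ⟨hc, c', hc', hrc', hk⟩) hcM
  · refine mem_movers.mpr ⟨hc'T, c, ?_, hrc'.symm, by omega⟩
    rw [hrc']
    exact mem_coCurves_symm hc hc'

/-! ## 2. The merged assignment -/

open scoped Classical in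
/-- The merged assignment: `r'` on `Mv`, `r` elsewhere. [this file] -/
noncomputable def mergeRows (Mv : Finset (Fin 3 → Fin (qOf m)))
    (r r' : (Fin 3 → Fin (qOf m)) → Fin m) : (Fin 3 → Fin (qOf m)) → Fin m :=
  fun c => if c ∈ Mv then r' c else r c

open scoped Classical in
/-- `mergeRows` on a mover. [this file] -/
theorem mergeRows_of_mem {Mv : Finset (Fin 3 → Fin (qOf m))} {r r' : (Fin 3 → Fin (qOf m)) → Fin m}
    {c : Fin 3 → Fin (qOf m)} (h : c ∈ Mv) : mergeRows Mv r r' c = r' c := by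
  unfold mergeRows; rw [if_pos h]

open scoped Classical in
/-- `mergeRows` on a non-mover. [this file] -/
theorem mergeRows_of_not_mem {Mv : Finset (Fin 3 → Fin (qOf m))}
    {r r' : (Fin 3 → Fin (qOf m)) → Fin m} {c : Fin 3 → Fin (qOf m)} (h : c ∉ Mv) :
    mergeRows Mv r r' c = r c := by
  unfold mergeRows; rw [if_neg h]

open scoped Classical in
/-- Admissibility (hence the row rule) survives the merge. [this file] -/
theorem mergeRows_mem {Mv : Finset (Fin 3 → Fin (qOf m))} {r r' : (Fin 3 → Fin (qOf m)) → Fin m}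
    (A : (Fin 3 → Fin (qOf m)) → Finset (Fin m)) (hr : ∀ c, r c ∈ A c)
    (hr' : ∀ c ∈ Mv, r' c ∈ A c) (c : Fin 3 → Fin (qOf m)) : mergeRows Mv r r' c ∈ A c := by
  by_cases h : c ∈ Mv
  · rw [mergeRows_of_mem h]; exact hr' c h
  · rw [mergeRows_of_not_mem h]; exact hr c

open scoped Classical in
/-- **THE ALTERATION STEP.**  Let `Mv ⊇` the movers of `(r, s₀, key)` (any superset within
which all collisions of `r` are confined: `hconf`).  If every `c ∈ Mv` gets a new row `r' c`
such that (a) no NON-mover co-curve through the new pivot cell pivots in that row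
(`r c' ≠ r' c`), and (b) no mover co-curve through it has the same new row (`r' c' ≠ r' c`),
then the merged assignment has `s₀` free at every pivot row. [this file] -/
theorem free_mergeRows {T : Finset (Fin 3 → Fin (qOf m))} {s₀ : Fin m}
    {r r' : (Fin 3 → Fin (qOf m)) → Fin m} {Mv : Finset (Fin 3 → Fin (qOf m))}
    (hconf : ∀ c ∈ T, c ∉ Mv → ∀ c' ∈ coCurves T c (r c, s₀), r c' = r c → c' ∈ Mv)
    (ha : ∀ c ∈ Mv, ∀ c' ∈ coCurves T c (r' c, s₀), c' ∉ Mv → r c' ≠ r' c)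
    (hb : ∀ c ∈ Mv, ∀ c' ∈ coCurves T c (r' c, s₀), c' ∈ Mv → r' c' ≠ r' c) :
    ∀ c ∈ T, s₀ ∈ freeCols T c (mergeRows Mv r r') (mergeRows Mv r r' c) := by
  intro c hc
  rw [mem_freeCols]
  intro c' hc'
  by_cases hcM : c ∈ Mv
  · rw [mergeRows_of_mem hcM] at hc' ⊢
    by_cases hc'M : c' ∈ Mv
    · rw [mergeRows_of_mem hc'M]; exact hb c hcM c' hc' hc'M
    · rw [mergeRows_of_not_mem hc'M]; exact ha c hcM c' hc' hc'M
  · rw [mergeRows_of_not_mem hcM] at hc' ⊢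
    by_cases hc'M : c' ∈ Mv
    · rw [mergeRows_of_mem hc'M]
      intro heq
      -- `c` is a non-mover co-curve of the mover `c'` through its new pivot cell
      have hcc' : c ∈ coCurves T c' (r' c', s₀) := by
        rw [heq]; exact mem_coCurves_symm hc hc'
      exact ha c' hc'M c hcc' hcM heq.symm
    · rw [mergeRows_of_not_mem hc'M]
      exact fun heq => hc'M (hconf c hc hcM c' hc' heq)

open scoped Classical in
/-- The movers of `(r, s₀, key)` confine all collisions (`hconf` of `free_mergeRows`).
[this file] -/
theorem movers_confine (T : Finset (Fin 3 → Fin (qOf m))) (s₀ : Fin m)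
    (r : (Fin 3 → Fin (qOf m)) → Fin m) (key : (Fin 3 → Fin (qOf m)) → ℕ) :
    ∀ c ∈ T, c ∉ movers T s₀ r key → ∀ c' ∈ coCurves T c (r c, s₀), r c' = r c →
      c' ∈ movers T s₀ r key :=
  fun _ hc hcM _ hc' hrc' => nonmovers_free hc hcM hc' hrc'

open scoped Classical in
/-- Condition (a) of `free_mergeRows` in terms of `blockedRows` of the NON-movers' assignment:
if the new row of the mover `c` is not blocked w.r.t. the restriction of `T` to the non-movers'
rows — concretely, if no co-curve `c' ∉ Mv` through `(r' c, s₀)` has `r c' = r' c` — then (a)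
holds; this is implied by `r' c ∉ blockedRows T c r s₀` (blocked by anyone). [this file] -/
theorem cond_a_of_not_blocked {T : Finset (Fin 3 → Fin (qOf m))} {s₀ : Fin m}
    {r r' : (Fin 3 → Fin (qOf m)) → Fin m} {Mv : Finset (Fin 3 → Fin (qOf m))}
    (h : ∀ c ∈ Mv, r' c ∉ blockedRows T c r s₀) :
    ∀ c ∈ Mv, ∀ c' ∈ coCurves T c (r' c, s₀), c' ∉ Mv → r c' ≠ r' c := by
  intro c hc c' hc' _ heq
  exact h c hc (mem_blockedRows.mpr ⟨c', hc', heq⟩)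

/-- **CLAUSE 1 after one round**: under the hypotheses of `free_mergeRows` the merged
assignment has injective pivots on `T`. [this file] -/
theorem injective_pivots_mergeRows {T : Finset (Fin 3 → Fin (qOf m))} {s₀ : Fin m}
    {r r' : (Fin 3 → Fin (qOf m)) → Fin m} (key : (Fin 3 → Fin (qOf m)) → ℕ)
    (ha : ∀ c ∈ movers T s₀ r key, r' c ∉ blockedRows T c r s₀)
    (hb : ∀ c ∈ movers T s₀ r key, ∀ c' ∈ coCurves T c (r' c, s₀),
      c' ∈ movers T s₀ r key → r' c' ≠ r' c) :
    ∀ c ∈ T, ∀ c' ∈ T,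
      cellEmb m c (mergeRows (movers T s₀ r key) r r' c, s₀) =
        cellEmb m c' (mergeRows (movers T s₀ r key) r r' c', s₀) → c = c' := by
  classical
  have hfree := free_mergeRows (movers_confine T s₀ r key) (cond_a_of_not_blocked ha) hb
  intro c hc c' hc' heq
  by_contra hne
  have hpos := pos_eq_of_cellEmb_eq m heq
  have hrow : mergeRows (movers T s₀ r key) r r' c = mergeRows (movers T s₀ r key) r r' c' :=
    (Prod.ext_iff.mp hpos).1
  have hc'co : c' ∈ coCurves T c (mergeRows (movers T s₀ r key) r r' c, s₀) :=
    mem_coCurves.mpr ⟨hc', fun h => hne h.symm, by rw [← hrow] at heq; exact heq.symm⟩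
  exact (mem_freeCols.mp (hfree c hc)) c' hc'co hrow.symm

end Summit.ValiantsHypothesis.ValiantsHypothesis.Theorems.DefinabilityGapAlterationStep
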